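import Literature.Topology.FourManifolds.CancellationModelLevels
import Literature.Topology.FourManifolds.RegularLevelSet
import HarnessLib

/-!
# Milnor's model `(F, η⃗)`: coordinates on the levels `F = a` near the axis (splitting off the
# axis coordinate, and straightening the level by the inverse function theorem)

Topic `Literature/Topology/FourManifolds` (fact seat
`provefact-Literature.Topology.FourManifolds.Cobord-8b1ec36bf6`, tenure on
`Literature.Topology.FourManifolds.Cobordism.Milnor1965_cancellation_modelChart`; fourth file of the
model infrastructure for the general case of Assertion 6 of the proof of Thm. 5.4, after
`CancellationModelLevels.lean`).  Everything here is **proved**; no named facts.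

Milnor, *Lectures on the h-cobordism theorem* (1965), proof of Thm. 5.4, Assertion 6 (held
copy, PDF pp. 31–32).  The general case compares two diffeomorphisms of a neighbourhood `U₁` of
`p₁` in the level `f⁻¹(b₁)` onto a neighbourhood of `p₂` in `f⁻¹(b₂)` — `h` (along `ξ`) and
`h₀ = g₂ h' g₁⁻¹` (along `η⃗` in the charts) — and applies the local Theorem 5.6 to `h₀⁻¹h`
written in coordinates `Rⁿ = Rᵃ × Rᵇ` of the level in which the right-hand sphere `S_R(b₁)`
is `Rᵃ` and `h₀⁻¹ S_L'(b₂)` is `Rᵇ`.  In the chart `g₁` these are the traces on the level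
`F = b₁` of the planes `x₁ = ⋯ = x_k = 0` and `x_{k+1} = ⋯ = 0` of the model, so the required
coordinates of the level are the model coordinates with the axis coordinate `x₀` dropped:
`(x_{k+1}, …, x_n) ∈ Rᵃ`, `(x₁, …, x_k) ∈ Rᵇ` (`a = n - k`, `b = k`).  Near the axis the level
`F = a` is a graph over these coordinates (`∂F/∂x₀ = 2v(x₀) ≠ 0` for `0 < x₀ < 1`), which is
recorded here through the local diffeomorphism `x ↦ (F(x) - a, (x_{k+1..n}, x_{1..k}))` of
`Rⁿ⁺¹` (inverse function theorem), whose first coordinate cuts out the level.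

## Contents (all proved)

* `Literature.Topology.FourManifolds.splitCoords n k hk : ℝⁿ⁺¹ →L[ℝ] ℝⁿ⁻ᵏ × ℝᵏ` — dropping
  `x₀` and splitting the remaining coordinates into the unstable block `x_{k+1..n}` and the
  stable block `x_{1..k}`; its kernel is the axis (`splitCoords_eq_zero_iff`,
  `eq_smul_single_of_splitCoords_eq_zero`), and the two blocks vanish exactly on the two model
  planes (`splitCoords_fst_eq_zero_iff`, `splitCoords_snd_eq_zero_iff`);
* `Literature.Topology.FourManifolds.levelMap n k hk w c₀ a x = (F x - a, splitCoords x)` for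
  the Morse function `F = milnorCancellationMorse k w c₀`: smooth, with derivative
  `(dF_x, splitCoords)` (`hasFDerivAt_levelMap`), injective — hence invertible — wherever
  `w(x₀) ≠ 0` (`fderiv_milnorCancellationMorse_single`: `dF_x(e₀) = 2w(x₀)`;
  `levelMapDeriv`), so that by the inverse function theorem it restricts to a chart of `ℝⁿ⁺¹`
  around any such point with smooth inverse (`exists_isLevelChart`, in the vocabulary
  `Literature.Topology.FourManifolds.IsLevelChart`: an `OpenPartialHomeomorph` agreeing with
  `levelMap`, smooth both ways);
* for a level chart `S`: `S.symm (c, y)` has `F = a + c` and coordinates `y`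
  (`IsLevelChart.apply_symm`, `IsLevelChart.splitCoords_symm`), and the axis point of the level
  corresponds to `(0, 0)` (`IsLevelChart.apply_smul_single`).

## References

* J. Milnor, *Lectures on the h-cobordism theorem*, notes by L. Siebenmann and J. Sondow,
  Princeton Mathematical Notes (1965): proof of Thm. 5.4, Assertion 6 (PDF pp. 30–32),
  Thm. 5.6 (PDF p. 32).  Held: `lit read book:milnornd-lectures-h-cobordism-theorem`.
  [MilnorHCobordism1965]
-/

open scoped Manifold ContDiff Topology NNReal
open Set Function Filter Module

noncomputable section

namespace Literature.Topology.FourManifolds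

/-- Local notation: `𝔼 n` is the model Euclidean space `EuclideanSpace ℝ (Fin n)`. -/
local notation "𝔼 " n:arg => EuclideanSpace ℝ (Fin n)

/-! ### Splitting off the axis coordinate -/

section Split

variable (n k : ℕ) (hk : k ≤ n)

/-- **The level coordinates of the model**: `x ↦ ((x_{k+1}, …, x_n), (x₁, …, x_k))`, dropping
the axis coordinate `x₀` and splitting the rest into the unstable block (Milnor's `Rᵃ`,
`a = n - k`, the coordinates in which `S_R` lies) and the stable block (`Rᵇ`, `b = k`).
[cite: MilnorHCobordism1965, proof of Thm. 5.4, Assertion 6 and Thm. 5.6 (PDF pp. 31–32)] -/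
def splitCoords : 𝔼 (n + 1) →L[ℝ] (𝔼 (n - k) × 𝔼 k) :=
  LinearMap.toContinuousLinearMap
    { toFun := fun x =>
        (WithLp.toLp 2 fun j : Fin (n - k) => x ⟨k + 1 + j, by have := j.2; omega⟩,
          WithLp.toLp 2 fun j : Fin k => x ⟨(j : ℕ) + 1, by have := j.2; omega⟩)
      map_add' := fun x y => by ext j <;> simp
      map_smul' := fun c x => by ext j <;> simp }

variable {n k hk}

/-- The unstable block. [cite: MilnorHCobordism1965, proof of Thm. 5.4, Assertion 6 (PDF p. 31)] -/
@[simp] theorem splitCoords_apply_fst (x : 𝔼 (n + 1)) (j : Fin (n - k)) :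
    (splitCoords n k hk x).1 j = x ⟨k + 1 + j, by have := j.2; omega⟩ := rfl

/-- The stable block. [cite: MilnorHCobordism1965, proof of Thm. 5.4, Assertion 6 (PDF p. 31)] -/
@[simp] theorem splitCoords_apply_snd (x : 𝔼 (n + 1)) (j : Fin k) :
    (splitCoords n k hk x).2 j = x ⟨(j : ℕ) + 1, by have := j.2; omega⟩ := rfl

/-- **The unstable block vanishes iff `x_{k+1} = ⋯ = x_n = 0`** (the plane carrying `S_L'`).
[cite: MilnorHCobordism1965, proof of Thm. 5.4, Assertion 6 (PDF p. 31)] -/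
theorem splitCoords_fst_eq_zero_iff (x : 𝔼 (n + 1)) :
    (splitCoords n k hk x).1 = 0 ↔ ∀ i : Fin (n + 1), k < (i : ℕ) → x i = 0 := by
  constructor
  · intro h i hi
    have hj : (i : ℕ) - (k + 1) < n - k := by have := i.2; omega
    have := congrArg (fun y : 𝔼 (n - k) => y ⟨(i : ℕ) - (k + 1), hj⟩) h
    simp only [splitCoords_apply_fst, PiLp.zero_apply] at this
    convert this using 2
    exact Fin.ext (by simp only; omega)
  · intro h
    ext j
    simp only [splitCoords_apply_fst, PiLp.zero_apply]
    exact h _ (by simp only; omega)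

/-- **The stable block vanishes iff `x₁ = ⋯ = x_k = 0`** (the plane carrying `S_R`).
[cite: MilnorHCobordism1965, proof of Thm. 5.4, Assertion 6 (PDF p. 31)] -/
theorem splitCoords_snd_eq_zero_iff (x : 𝔼 (n + 1)) :
    (splitCoords n k hk x).2 = 0 ↔ ∀ i : Fin (n + 1), (i : ℕ) ≠ 0 → (i : ℕ) ≤ k → x i = 0 := by
  constructor
  · intro h i hi0 hik
    have hj : (i : ℕ) - 1 < k := by omega
    have := congrArg (fun y : 𝔼 k => y ⟨(i : ℕ) - 1, hj⟩) h
    simp only [splitCoords_apply_snd, PiLp.zero_apply] at this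
    convert this using 2
    exact Fin.ext (by simp only; omega)
  · intro h
    ext j
    simp only [splitCoords_apply_snd, PiLp.zero_apply]
    exact h _ (by simp) (by simp only; omega)

/-- **The kernel of the level coordinates is the axis**: all coordinates but `x₀` vanish.
[cite: MilnorHCobordism1965, proof of Thm. 5.4, Assertion 6 (PDF p. 31)] -/
theorem splitCoords_eq_zero_iff (x : 𝔼 (n + 1)) :
    splitCoords n k hk x = 0 ↔ ∀ i : Fin (n + 1), (i : ℕ) ≠ 0 → x i = 0 := by
  rw [Prod.ext_iff, Prod.fst_zero, Prod.snd_zero, splitCoords_fst_eq_zero_iff,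
    splitCoords_snd_eq_zero_iff]
  constructor
  · rintro ⟨h1, h2⟩ i hi
    by_cases hik : (i : ℕ) ≤ k
    · exact h2 i hi hik
    · exact h1 i (not_le.1 hik)
  · intro h
    exact ⟨fun i hi => h i (by omega), fun i hi _ => h i hi⟩

/-- A vector with vanishing level coordinates is on the axis: `x = x₀ e₀`. [cite: MilnorHCobordism1965, proof of Thm. 5.4, Assertion 6 (PDF p. 31)] -/
theorem eq_smul_single_of_splitCoords_eq_zero {x : 𝔼 (n + 1)} (hx : splitCoords n k hk x = 0) :
    x = x 0 • EuclideanSpace.single (0 : Fin (n + 1)) (1 : ℝ) := by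
  rw [splitCoords_eq_zero_iff] at hx
  ext i
  by_cases hi : i = 0
  · subst hi; simp
  · have hi' : (i : ℕ) ≠ 0 := fun h => hi (Fin.ext (by rw [h, Fin.val_zero]))
    simp [hi, hx i hi']

/-- Axis points have vanishing level coordinates. [cite: MilnorHCobordism1965, proof of Thm. 5.4, Assertion 6 (PDF p. 31)] -/
@[simp] theorem splitCoords_smul_single (s : ℝ) :
    splitCoords n k hk (s • EuclideanSpace.single (0 : Fin (n + 1)) (1 : ℝ)) = 0 := by
  rw [splitCoords_eq_zero_iff]
  intro i hi
  have hi' : i ≠ 0 := fun h => hi (by rw [h, Fin.val_zero])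
  simp [hi']

/-- Two vectors with the same level coordinates and the same `x₀` coincide. [folklore] -/
theorem eq_of_splitCoords_eq {x y : 𝔼 (n + 1)} (h : splitCoords n k hk x = splitCoords n k hk y)
    (h0 : x 0 = y 0) : x = y := by
  have hxy : splitCoords n k hk (x - y) = 0 := by rw [map_sub, h, sub_self]
  have := eq_smul_single_of_splitCoords_eq_zero hxy
  rw [PiLp.sub_apply, h0, sub_self, zero_smul, sub_eq_zero] at this
  exact this

end Split

/-! ### Straightening the levels: the inverse function theorem -/

section Level

variable (n k : ℕ) (hk : k ≤ n) (w : ℝ → ℝ) (c₀ a : ℝ)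

/-- **The level map** `x ↦ (F(x) - a, level coordinates of x)` of the model, whose first
coordinate cuts out the level `F = a` of `F = milnorCancellationMorse k w c₀`.
[cite: MilnorHCobordism1965, proof of Thm. 5.4, Assertion 6 (PDF p. 31)] -/
def levelMap (x : 𝔼 (n + 1)) : ℝ × (𝔼 (n - k) × 𝔼 k) :=
  (milnorCancellationMorse k w c₀ x - a, splitCoords n k hk x)

variable {n k hk w c₀ a}

/-- Unfolding `levelMap`. [folklore] -/
@[simp] theorem levelMap_apply (x : 𝔼 (n + 1)) :
    levelMap n k hk w c₀ a x = (milnorCancellationMorse k w c₀ x - a, splitCoords n k hk x) := rfl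

/-- The level map is smooth for a smooth profile. [folklore] -/
theorem contDiff_levelMap (hw : ContDiff ℝ ∞ w) : ContDiff ℝ ∞ (levelMap n k hk w c₀ a) :=
  ((contDiff_milnorCancellationMorse k hw c₀).sub contDiff_const).prodMk (splitCoords n k hk).contDiff

/-- **`dF_x(e₀) = 2w(x₀)`**: the derivative of Milnor's `F` in the direction of the axis.
[cite: MilnorHCobordism1965, proof of Thm. 5.4, Assertion 6 (PDF p. 30)] -/
theorem fderiv_milnorCancellationMorse_single (hw : ContDiff ℝ ∞ w) (x : 𝔼 (n + 1)) :
    fderiv ℝ (milnorCancellationMorse k w c₀) x (EuclideanSpace.single (0 : Fin (n + 1)) (1 : ℝ)) =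
      2 * w (x 0) := by
  set e₀ : 𝔼 (n + 1) := EuclideanSpace.single (0 : Fin (n + 1)) (1 : ℝ) with he₀
  have hline : HasDerivAt (fun s : ℝ => x + s • e₀) e₀ 0 := by
    simpa using ((hasDerivAt_id (0 : ℝ)).smul_const e₀).const_add x
  have h1 := hasDerivAt_milnorCancellationMorse_comp k hw.continuous c₀ hline
  have h2 : HasDerivAt (fun s : ℝ => milnorCancellationMorse k w c₀ (x + s • e₀))
      (fderiv ℝ (milnorCancellationMorse k w c₀) x e₀) 0 := by
    have h := ((contDiff_milnorCancellationMorse (m := n + 1) k hw c₀).differentiable (by simp)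
      (x + (0 : ℝ) • e₀)).hasFDerivAt.comp_hasDerivAt (0 : ℝ) hline
    simpa [Function.comp_def] using h
  rw [h2.unique h1]
  simp only [zero_smul, add_zero, he₀]
  have hs : ∑ i ∈ Finset.univ.filter (fun i : Fin (n + 1) => (i : ℕ) ≠ 0 ∧ (i : ℕ) ≤ k),
      (EuclideanSpace.single (0 : Fin (n + 1)) (1 : ℝ) i * x i +
        x i * EuclideanSpace.single (0 : Fin (n + 1)) (1 : ℝ) i) = 0 := by
    refine Finset.sum_eq_zero fun i hi => ?_
    have hi0 : i ≠ 0 := fun h => (Finset.mem_filter.1 hi).2.1 (by rw [h, Fin.val_zero])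
    simp [hi0]
  have hu : ∑ i ∈ Finset.univ.filter (fun i : Fin (n + 1) => k < (i : ℕ)),
      (EuclideanSpace.single (0 : Fin (n + 1)) (1 : ℝ) i * x i +
        x i * EuclideanSpace.single (0 : Fin (n + 1)) (1 : ℝ) i) = 0 := by
    refine Finset.sum_eq_zero fun i hi => ?_
    have hi0 : i ≠ 0 := fun h => by
      have := (Finset.mem_filter.1 hi).2
      rw [h, Fin.val_zero] at this
      exact Nat.not_lt_zero k this
    simp [hi0]
  rw [hs, hu]
  simp

/-- **The derivative of the level map** is `(dF_x, splitCoords)`. [folklore] -/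
theorem hasFDerivAt_levelMap (hw : ContDiff ℝ ∞ w) (x : 𝔼 (n + 1)) :
    HasFDerivAt (levelMap n k hk w c₀ a)
      ((fderiv ℝ (milnorCancellationMorse k w c₀) x).prod (splitCoords n k hk)) x :=
  (((contDiff_milnorCancellationMorse (m := n + 1) k hw c₀).differentiable (by simp) x).hasFDerivAt.sub_const a).prodMk
    (splitCoords n k hk).hasFDerivAt

/-- **The derivative of the level map is injective wherever `w(x₀) ≠ 0`**: a vector in its
kernel has vanishing level coordinates, so lies on the axis, where `dF = 2w(x₀) dx₀`.
[cite: MilnorHCobordism1965, proof of Thm. 5.4, Assertion 6 (PDF p. 31)] -/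
theorem injective_fderiv_levelMap (hw : ContDiff ℝ ∞ w) {x : 𝔼 (n + 1)} (hx : w (x 0) ≠ 0) :
    Function.Injective ((fderiv ℝ (milnorCancellationMorse k w c₀) x).prod (splitCoords n k hk)) := by
  rw [injective_iff_map_eq_zero]
  intro ξ hξ
  rw [ContinuousLinearMap.prod_apply, Prod.mk_eq_zero] at hξ
  have hξ' := eq_smul_single_of_splitCoords_eq_zero hξ.2
  have h1 := hξ.1
  rw [hξ', map_smul, fderiv_milnorCancellationMorse_single hw, smul_eq_mul] at h1
  have h0 : ξ 0 = 0 := by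
    rcases mul_eq_zero.1 h1 with h | h
    · exact h
    · exact absurd h (mul_ne_zero two_ne_zero hx)
  rw [hξ', h0, zero_smul]

/-- The dimensions agree: `dim ℝⁿ⁺¹ = dim (ℝ × (ℝⁿ⁻ᵏ × ℝᵏ))` for `k ≤ n`. [folklore] -/
theorem finrank_eq_finrank_levelTarget (hk : k ≤ n) :
    finrank ℝ (𝔼 (n + 1)) = finrank ℝ (ℝ × (𝔼 (n - k) × 𝔼 k)) := by
  rw [finrank_euclideanSpace_fin, Module.finrank_prod, Module.finrank_prod, Module.finrank_self,
    finrank_euclideanSpace_fin, finrank_euclideanSpace_fin]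
  omega

/-- **The derivative of the level map as a linear isomorphism** (injective between spaces of
the same dimension), wherever `w(x₀) ≠ 0`. [cite: MilnorHCobordism1965, proof of Thm. 5.4, Assertion 6 (PDF p. 31)] -/
def levelMapDeriv (hw : ContDiff ℝ ∞ w) {x : 𝔼 (n + 1)} (hx : w (x 0) ≠ 0) :
    𝔼 (n + 1) ≃L[ℝ] (ℝ × (𝔼 (n - k) × 𝔼 k)) :=
  ContinuousLinearEquiv.ofBijective
    ((fderiv ℝ (milnorCancellationMorse k w c₀) x).prod (splitCoords n k hk))
    (LinearMap.ker_eq_bot.2 (injective_fderiv_levelMap hw hx))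
    (LinearMap.range_eq_top.2
      ((LinearMap.injective_iff_surjective_of_finrank_eq_finrank
        (finrank_eq_finrank_levelTarget hk)).1 (injective_fderiv_levelMap hw hx)))

/-- The isomorphism `levelMapDeriv` is the derivative `(dF_x, splitCoords)`. [folklore] -/
theorem coe_levelMapDeriv (hw : ContDiff ℝ ∞ w) {x : 𝔼 (n + 1)} (hx : w (x 0) ≠ 0) :
    (levelMapDeriv (hk := hk) (c₀ := c₀) hw hx : 𝔼 (n + 1) →L[ℝ] (ℝ × (𝔼 (n - k) × 𝔼 k))) =
      (fderiv ℝ (milnorCancellationMorse k w c₀) x).prod (splitCoords n k hk) :=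
  ContinuousLinearEquiv.coe_ofBijective _ _ _

/-- The level map has the isomorphism `levelMapDeriv` as its derivative. [folklore] -/
theorem hasFDerivAt_levelMap_equiv (hw : ContDiff ℝ ∞ w) {x : 𝔼 (n + 1)} (hx : w (x 0) ≠ 0) :
    HasFDerivAt (levelMap n k hk w c₀ a)
      (levelMapDeriv (hk := hk) (c₀ := c₀) hw hx : 𝔼 (n + 1) →L[ℝ] (ℝ × (𝔼 (n - k) × 𝔼 k))) x := by
  rw [coe_levelMapDeriv]
  exact hasFDerivAt_levelMap hw x

variable (n k hk w c₀ a) in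
/-- **A level chart**: an `OpenPartialHomeomorph` of `ℝⁿ⁺¹` which is the level map on its
source, smooth with smooth inverse (the output of the inverse function theorem; its first
coordinate is `F - a`, so it straightens the level `F = a`, and its other coordinates are the
level coordinates `splitCoords`). [cite: MilnorHCobordism1965, proof of Thm. 5.4, Assertion 6 (PDF p. 31)] -/
structure IsLevelChart (S : OpenPartialHomeomorph (𝔼 (n + 1)) (ℝ × (𝔼 (n - k) × 𝔼 k))) : Prop where
  /-- On its source the chart is the level map. -/
  coe_eq : ⇑S = levelMap n k hk w c₀ a
  /-- The chart is smooth. -/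
  contDiffOn : ContDiffOn ℝ ∞ S S.source
  /-- Its inverse is smooth. -/
  contDiffOn_symm : ContDiffOn ℝ ∞ S.symm S.target

/-- **Existence of level charts** (inverse function theorem, `RegularLevelSet.lean`'s
packaging `exists_openPartialHomeomorph_contDiffOn_symm`): around every point with
`w(x₀) ≠ 0`, inside any prescribed open set. [cite: MilnorHCobordism1965, proof of Thm. 5.4, Assertion 6 (PDF p. 31)] -/
theorem exists_isLevelChart (hw : ContDiff ℝ ∞ w) {x₀ : 𝔼 (n + 1)} (hx₀ : w (x₀ 0) ≠ 0)
    {O : Set (𝔼 (n + 1))} (hO : IsOpen O) (hxO : x₀ ∈ O) :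
    ∃ S : OpenPartialHomeomorph (𝔼 (n + 1)) (ℝ × (𝔼 (n - k) × 𝔼 k)),
      IsLevelChart n k hk w c₀ a S ∧ x₀ ∈ S.source ∧ S.source ⊆ O := by
  obtain ⟨S, hS, hx, hsub, h1, h2⟩ := exists_openPartialHomeomorph_contDiffOn_symm hO hxO
    (m := ∞) (by simp) (contDiff_levelMap (hk := hk) (c₀ := c₀) (a := a) hw).contDiffOn
    (levelMapDeriv (hk := hk) (c₀ := c₀) hw hx₀) (hasFDerivAt_levelMap_equiv hw hx₀)
  exact ⟨S, ⟨hS, h1, h2⟩, hx, hsub⟩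

namespace IsLevelChart

variable {S : OpenPartialHomeomorph (𝔼 (n + 1)) (ℝ × (𝔼 (n - k) × 𝔼 k))}

/-- The value of a level chart. [folklore] -/
theorem apply (h : IsLevelChart n k hk w c₀ a S) (x : 𝔼 (n + 1)) :
    S x = (milnorCancellationMorse k w c₀ x - a, splitCoords n k hk x) := by
  rw [h.coe_eq, levelMap_apply]

/-- **The inverse chart: the first coordinate is `F - a`.** [cite: MilnorHCobordism1965, proof of Thm. 5.4, Assertion 6 (PDF p. 31)] -/
theorem apply_symm (h : IsLevelChart n k hk w c₀ a S) {q : ℝ × (𝔼 (n - k) × 𝔼 k)}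
    (hq : q ∈ S.target) : milnorCancellationMorse k w c₀ (S.symm q) = a + q.1 := by
  have := congrArg Prod.fst (S.right_inv hq)
  rw [h.apply] at this
  simp only at this
  linarith

/-- **The inverse chart: the other coordinates are the level coordinates.** [cite: MilnorHCobordism1965, proof of Thm. 5.4, Assertion 6 (PDF p. 31)] -/
theorem splitCoords_symm (h : IsLevelChart n k hk w c₀ a S) {q : ℝ × (𝔼 (n - k) × 𝔼 k)}
    (hq : q ∈ S.target) : splitCoords n k hk (S.symm q) = q.2 := by
  have := congrArg Prod.snd (S.right_inv hq)
  rwa [h.apply] at this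

/-- Points `S.symm (0, y)` lie on the level `F = a`. [cite: MilnorHCobordism1965, proof of Thm. 5.4, Assertion 6 (PDF p. 31)] -/
theorem apply_symm_zero (h : IsLevelChart n k hk w c₀ a S) {y : 𝔼 (n - k) × 𝔼 k}
    (hy : ((0 : ℝ), y) ∈ S.target) : milnorCancellationMorse k w c₀ (S.symm (0, y)) = a := by
  rw [h.apply_symm hy, add_zero]

/-- A point of the source on the level `F = a` is `S.symm (0, its coordinates)`. [folklore] -/
theorem symm_zero_splitCoords (h : IsLevelChart n k hk w c₀ a S) {x : 𝔼 (n + 1)} (hx : x ∈ S.source)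
    (hxa : milnorCancellationMorse k w c₀ x = a) : S.symm (0, splitCoords n k hk x) = x := by
  have : S x = (0, splitCoords n k hk x) := by rw [h.apply, hxa, sub_self]
  rw [← this, S.left_inv hx]

/-- **The axis point of the level has coordinates `(0, 0)`**: if `s e₀ ∈ S.source` with
`F(s e₀) = a` then `S (s e₀) = (0, 0)`. [cite: MilnorHCobordism1965, proof of Thm. 5.4, Assertion 6 (PDF p. 31)] -/
theorem apply_smul_single (h : IsLevelChart n k hk w c₀ a S) {s : ℝ}
    (hs : milnorCancellationMorse k w c₀ (s • EuclideanSpace.single (0 : Fin (n + 1)) (1 : ℝ)) = a) :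
    S (s • EuclideanSpace.single (0 : Fin (n + 1)) (1 : ℝ)) = (0, 0) := by
  rw [h.apply, hs, sub_self, splitCoords_smul_single]

/-- The chart is smooth at the points of its source. [folklore] -/
theorem contDiffAt (h : IsLevelChart n k hk w c₀ a S) {x : 𝔼 (n + 1)} (hx : x ∈ S.source) :
    ContDiffAt ℝ ∞ S x :=
  h.contDiffOn.contDiffAt (S.open_source.mem_nhds hx)

/-- The inverse chart is smooth at the points of its target. [folklore] -/
theorem contDiffAt_symm (h : IsLevelChart n k hk w c₀ a S) {q : ℝ × (𝔼 (n - k) × 𝔼 k)}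
    (hq : q ∈ S.target) : ContDiffAt ℝ ∞ S.symm q :=
  h.contDiffOn_symm.contDiffAt (S.open_target.mem_nhds hq)

end IsLevelChart

end Level

end Literature.Topology.FourManifolds
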